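import Summits.Ventures.WeilGRH.TwistedGramAtoms
import Summits.Ventures.WeilGRH.ZetaWindowAtomsLimit
import HarnessLib

/-!
# GRH arm (rh-explicit, venture WeilGRH): TWISTED GRAM FORMS EXCLUDE ZEROS OF `L(s, χ)` FROM BLOCKS —
  `m · μ[l, r] ≤ 𝓔^χ_a(u) − M^χ_a‖u‖²` for every representing `μ`, every trigonometric window `u = Σ c_n χ_n`
  and every floor `m ≤ ‖û(½+it)‖²` on `[l, r]`

Cell `rh-explicit`, WEIL TRACK (structure seat weil-3, gen16).  The `χ`-twin of `GramFormExclusion.lean` and the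
BLOCK version of `TwistedGramAtoms.lean` (the point case `μ{τ}`).  For `χ` mod `q ≠ 1`, `a > 0` and every
positive `μ` representing `Q_χ` on the tests of `[-a, a]` (the growth `(1+t²)⁻¹ ∈ L¹(μ)` is automatic,
`integrable_inv_one_add_sq_of_represents`), the twisted window form of `u = Σ_{n∈s} c_n χ_n` is the moment
`∫ ‖û(½+it)‖² dμ(t)` (`TwistedWindowMeasure.twistedWindowForm_sum_smul_chi_eq_integral`).  Hence, with
`𝓠^χ_a(u) := 𝓔^χ_a(u) − M^χ_a‖u‖₂²`:

* `twistedWindowForm_sum_smul_chi_nonneg_of_represents`: `0 ≤ 𝓠^χ_a(u)`;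
* **`blockMass_le_twistedWindowForm`**: `m ≤ ‖û(½+it)‖²` on `[l, r]` ⟹ `m · μ[l, r] ≤ 𝓠^χ_a(u)`;
* `measureReal_block_lt_of_twistedWindowForm_lt`: `𝓠^χ_a(u) < k·m` ⟹ `μ[l, r] < k`; in particular
  (`k = 1`, `measure_block_eq_zero_of_natValued_of_twistedWindowForm_lt`) an `ℕ`-valued representing measure gives
  the block mass `0`;
* ★ **`im_not_mem_block_of_grh_of_twistedWindowForm_lt`**: under `GRH(χ)` (`χ` primitive), ONE coefficient
  vector with `𝓠^χ_a(Σ c_n χ_n) < m ≤ ‖(Σ c_n χ_n)^(½+it)‖²` on `[l, r]` certifies that NO non-trivial zero of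
  `L(s, χ)` has ordinate in `[l, r]`; `charZeroHeightMeasure_real_block_lt_of_grh`: `𝓠^χ_a(u) < k·m` bounds the
  number of zeros with ordinate in `[l, r]`, counted with multiplicity, by `< k`.

This is the statement shape through which the kernel-checked twisted Gram enclosures of the GRH arm
(`TwistedGramEntryBoxC.mem_twistedGramCBox`) become zero-free blocks and multiplicity bounds for `L(s, χ)`,
exactly as the `ζ`-side certificates of `GramFormExclusion.lean`.  No definitions, no named facts.
-/

set_option autoImplicit false

noncomputable section

open Complex Set MeasureTheory
open scoped Real ENNReal ComplexConjugate

namespace Summit.Ventures.WeilGRH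

open Literature.NumberTheory.LFunctions
open Literature.NumberTheory.LFunctions.Yoshida1992 (chi)
open Literature.NumberTheory.LFunctions.ExplicitPsiChar
open Literature.NumberTheory.LFunctions.WeilBochner (charZeroHeightMeasure
  weilQuadraticChar_eq_integral_of_riemannHypothesis)

variable {q : ℕ} {a : ℝ}

/-! ## Every representing measure: the twisted form dominates the block masses -/

/-- **Positivity on trigonometric windows from a representing measure**: for `χ` mod `q ≠ 1`, `a > 0`, every
positive `μ` representing `Q_χ` on the tests of `[-a, a]`, every finite `s ⊆ ℤ` and `c : ℤ → ℂ`,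
`0 ≤ 𝓔^χ_a(Σ c_n χ_n) − M^χ_a‖Σ c_n χ_n‖₂²`. -/
theorem twistedWindowForm_sum_smul_chi_nonneg_of_represents (hq : q ≠ 1) (χ : DirichletCharacter ℂ q)
    (ha : 0 < a) {μ : Measure ℝ}
    (hμ : ∀ g : ℝ → ℂ, IsWeilTest g → tsupport g ⊆ Icc (-a) a →
      Integrable (fun t : ℝ ↦ ‖weilMellin g (1 / 2 + t * I)‖ ^ 2) μ ∧
        weilQuadraticChar χ g = ((∫ t, ‖weilMellin g (1 / 2 + t * I)‖ ^ 2 ∂μ : ℝ) : ℂ))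
    (s : Finset ℤ) (c : ℤ → ℂ) :
    0 ≤ weilDirichletEnergyChar χ a (∑ n ∈ s, c n • chi a n) -
        weilMarkovConstantChar χ a * ∫ x : ℝ, ‖(∑ n ∈ s, c n • chi a n) x‖ ^ 2 := by
  rw [(twistedWindowForm_sum_smul_chi_eq_integral hq χ ha hμ
    (integrable_inv_one_add_sq_of_represents χ ha hμ) s c).2]
  exact integral_nonneg fun t ↦ by positivity

/-- ★ **THE TWISTED FORM DOMINATES THE BLOCK MASSES.**  For `χ` mod `q ≠ 1`, `a > 0`, every positive `μ`
representing `Q_χ` on the tests of `[-a, a]`, every finite `s ⊆ ℤ`, `c : ℤ → ℂ` and every block `[l, r]` on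
which `m ≤ ‖(Σ c_n χ_n)^(½+it)‖²`:  `m · μ[l, r] ≤ 𝓔^χ_a(Σ c_n χ_n) − M^χ_a‖Σ c_n χ_n‖₂²`. -/
theorem blockMass_le_twistedWindowForm (hq : q ≠ 1) (χ : DirichletCharacter ℂ q) (ha : 0 < a)
    {μ : Measure ℝ}
    (hμ : ∀ g : ℝ → ℂ, IsWeilTest g → tsupport g ⊆ Icc (-a) a →
      Integrable (fun t : ℝ ↦ ‖weilMellin g (1 / 2 + t * I)‖ ^ 2) μ ∧
        weilQuadraticChar χ g = ((∫ t, ‖weilMellin g (1 / 2 + t * I)‖ ^ 2 ∂μ : ℝ) : ℂ))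
    (s : Finset ℤ) (c : ℤ → ℂ) {l r m : ℝ}
    (hm : ∀ t ∈ Icc l r, m ≤ ‖weilMellin (∑ n ∈ s, c n • chi a n) (1 / 2 + t * I)‖ ^ 2) :
    m * μ.real (Icc l r) ≤ weilDirichletEnergyChar χ a (∑ n ∈ s, c n • chi a n) -
        weilMarkovConstantChar χ a * ∫ x : ℝ, ‖(∑ n ∈ s, c n • chi a n) x‖ ^ 2 := by
  have hI := integrable_inv_one_add_sq_of_represents χ ha hμ
  obtain ⟨hint, heq⟩ := twistedWindowForm_sum_smul_chi_eq_integral hq χ ha hμ hI s c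
  rw [heq]
  have hBfin : μ (Icc l r) ≠ ⊤ := (measure_Icc_lt_top_of_integrable hI l r).ne
  have hind : Integrable ((Icc l r).indicator fun _ ↦ m) μ :=
    (integrable_indicator_iff measurableSet_Icc).2 (integrableOn_const hBfin)
  have hle : ∀ t : ℝ, (Icc l r).indicator (fun _ ↦ m) t ≤
      ‖weilMellin (∑ n ∈ s, c n • chi a n) (1 / 2 + t * I)‖ ^ 2 := by
    intro t
    by_cases ht : t ∈ Icc l r
    · rw [indicator_of_mem ht]; exact hm t ht
    · rw [indicator_of_notMem ht]; positivity
  calc m * μ.real (Icc l r) = ∫ t, (Icc l r).indicator (fun _ ↦ m) t ∂μ := by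
        rw [integral_indicator_const _ measurableSet_Icc, smul_eq_mul, mul_comm]
    _ ≤ ∫ t, ‖weilMellin (∑ n ∈ s, c n • chi a n) (1 / 2 + t * I)‖ ^ 2 ∂μ := integral_mono hind hint hle

/-- **A certificate value below `k·(floor)` gives block mass `< k`**: if `m ≤ ‖û‖²` on `[l, r]`, `0 < k` and
`𝓔^χ_a(u) − M^χ_a‖u‖₂² < k · m` (`u = Σ c_n χ_n`), then `μ[l, r] < k` for every representing `μ`. -/
theorem measureReal_block_lt_of_twistedWindowForm_lt (hq : q ≠ 1) (χ : DirichletCharacter ℂ q) (ha : 0 < a)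
    {μ : Measure ℝ}
    (hμ : ∀ g : ℝ → ℂ, IsWeilTest g → tsupport g ⊆ Icc (-a) a →
      Integrable (fun t : ℝ ↦ ‖weilMellin g (1 / 2 + t * I)‖ ^ 2) μ ∧
        weilQuadraticChar χ g = ((∫ t, ‖weilMellin g (1 / 2 + t * I)‖ ^ 2 ∂μ : ℝ) : ℂ))
    (s : Finset ℤ) (c : ℤ → ℂ) {l r m k : ℝ} (hk : 0 < k)
    (hm : ∀ t ∈ Icc l r, m ≤ ‖weilMellin (∑ n ∈ s, c n • chi a n) (1 / 2 + t * I)‖ ^ 2)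
    (hlt : weilDirichletEnergyChar χ a (∑ n ∈ s, c n • chi a n) -
        weilMarkovConstantChar χ a * (∫ x : ℝ, ‖(∑ n ∈ s, c n • chi a n) x‖ ^ 2) < k * m) :
    μ.real (Icc l r) < k := by
  have h := blockMass_le_twistedWindowForm hq χ ha hμ s c hm
  have h0 := twistedWindowForm_sum_smul_chi_nonneg_of_represents hq χ ha hμ s c
  have hμ0 : 0 ≤ μ.real (Icc l r) := measureReal_nonneg
  by_contra hge
  have hge' : k ≤ μ.real (Icc l r) := not_lt.1 hge
  nlinarith

/-- **`ℕ`-valued representing measures: a certificate below the floor EMPTIES the block.**  If `μ` represents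
`Q_χ` on the tests of `[-a, a]` and gives every bounded measurable set a natural-number mass (as the zero-height
measure `ν_χ` does under `GRH(χ)`), `m ≤ ‖û‖²` on `[l, r]` and `𝓔^χ_a(u) − M^χ_a‖u‖₂² < m`, then `μ[l, r] = 0`. -/
theorem measure_block_eq_zero_of_natValued_of_twistedWindowForm_lt (hq : q ≠ 1) (χ : DirichletCharacter ℂ q)
    (ha : 0 < a) {μ : Measure ℝ}
    (hμ : ∀ g : ℝ → ℂ, IsWeilTest g → tsupport g ⊆ Icc (-a) a →
      Integrable (fun t : ℝ ↦ ‖weilMellin g (1 / 2 + t * I)‖ ^ 2) μ ∧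
        weilQuadraticChar χ g = ((∫ t, ‖weilMellin g (1 / 2 + t * I)‖ ^ 2 ∂μ : ℝ) : ℂ))
    (hN : ∀ S : Set ℝ, MeasurableSet S → Bornology.IsBounded S → ∃ k : ℕ, μ.real S = k)
    (s : Finset ℤ) (c : ℤ → ℂ) {l r m : ℝ}
    (hm : ∀ t ∈ Icc l r, m ≤ ‖weilMellin (∑ n ∈ s, c n • chi a n) (1 / 2 + t * I)‖ ^ 2)
    (hlt : weilDirichletEnergyChar χ a (∑ n ∈ s, c n • chi a n) -
        weilMarkovConstantChar χ a * (∫ x : ℝ, ‖(∑ n ∈ s, c n • chi a n) x‖ ^ 2) < m) :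
    μ (Icc l r) = 0 := by
  obtain ⟨k, hk⟩ := hN _ measurableSet_Icc (Metric.isBounded_Icc l r)
  have h1 := measureReal_block_lt_of_twistedWindowForm_lt hq χ ha hμ s c one_pos hm (by rwa [one_mul])
  rw [hk] at h1
  have hk1 : k < 1 := by exact_mod_cast h1
  have hk0 : k = 0 := Nat.lt_one_iff.1 hk1
  have h0 : μ.real (Icc l r) = 0 := by rw [hk, hk0, Nat.cast_zero]
  rw [measureReal_def, ENNReal.toReal_eq_zero_iff] at h0
  exact h0.resolve_right
    (measure_Icc_lt_top_of_integrable (integrable_inv_one_add_sq_of_represents χ ha hμ) l r).ne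

/-! ## Under `GRH(χ)`: zero-free blocks and multiplicity bounds for `L(s, χ)` -/

section GRH

variable [NeZero q] {χ : DirichletCharacter ℂ q}

/-- Under `GRH(χ)` (`χ` primitive mod `q ≠ 1`) the zero-height measure `ν_χ` represents `Q_χ` on the tests of
every window. -/
private theorem represents_charZeroHeightMeasure (hq : q ≠ 1) (hprim : χ.IsPrimitive)
    (hGRH : χ.RiemannHypothesis) (a : ℝ) :
    ∀ g : ℝ → ℂ, IsWeilTest g → tsupport g ⊆ Icc (-a) a →
      Integrable (fun t : ℝ ↦ ‖weilMellin g (1 / 2 + t * I)‖ ^ 2) (charZeroHeightMeasure χ) ∧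
        weilQuadraticChar χ g =
          ((∫ t, ‖weilMellin g (1 / 2 + t * I)‖ ^ 2 ∂charZeroHeightMeasure χ : ℝ) : ℂ) :=
  fun _ hg _ ↦ weilQuadraticChar_eq_integral_of_riemannHypothesis hq hprim hGRH hg

/-- A non-trivial zero `ρ` of `L(s, χ)` (`χ ≠ 1`) puts mass `≥ 1` on every block holding its ordinate:
`1 ≤ ν_χ[l, r]` whenever `Im ρ ∈ [l, r]`. -/
theorem one_le_charZeroHeightMeasure_block (hχ : χ ≠ 1) {ρ : ℂ} (hρ : ρ ∈ charNontrivialZeros χ) {l r : ℝ}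
    (hmem : ρ.im ∈ Icc l r) : (1 : ℝ≥0∞) ≤ charZeroHeightMeasure χ (Icc l r) := by
  have hle : ((DirichletDisc.zeroOrder χ ρ : ℕ) : ℝ≥0∞) • Measure.dirac ρ.im ≤ charZeroHeightMeasure χ := by
    rw [charZeroHeightMeasure]
    exact Measure.le_sum (fun ρ' : charNontrivialZeros χ ↦
      ((DirichletDisc.zeroOrder χ (ρ' : ℂ) : ℕ) : ℝ≥0∞) • Measure.dirac (ρ' : ℂ).im) ⟨ρ, hρ⟩
  have hord : (1 : ℝ≥0∞) ≤ ((DirichletDisc.zeroOrder χ ρ : ℕ) : ℝ≥0∞) := by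
    have h : 0 < DirichletDisc.zeroOrder χ ρ := (DirichletDisc.zeroOrder_pos_iff χ hχ ρ).2 hρ.1
    exact_mod_cast h
  have hdirac : (1 : ℝ≥0∞) ≤ Measure.dirac ρ.im (Icc l r) := by
    have h := Measure.le_dirac_apply (a := ρ.im) (s := Icc l r)
    rwa [indicator_of_mem hmem, Pi.one_apply] at h
  calc (1 : ℝ≥0∞) = 1 * 1 := (one_mul 1).symm
    _ ≤ ((DirichletDisc.zeroOrder χ ρ : ℕ) : ℝ≥0∞) * Measure.dirac ρ.im (Icc l r) := mul_le_mul' hord hdirac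
    _ = (((DirichletDisc.zeroOrder χ ρ : ℕ) : ℝ≥0∞) • Measure.dirac ρ.im) (Icc l r) := by
        rw [Measure.smul_apply, smul_eq_mul]
    _ ≤ charZeroHeightMeasure χ (Icc l r) := Measure.le_iff'.1 hle _

/-- ★ **ONE VECTOR ON ONE TWISTED GRAM BLOCK IS A ZERO-FREE-BLOCK CERTIFICATE FOR `L(s, χ)`** (under `GRH(χ)`).
For `χ` primitive mod `q ≠ 1` satisfying `GRH(χ)`, every `a > 0`, modes `s`, coefficients `c : ℤ → ℂ` and block
`[l, r]` with `m ≤ ‖(Σ c_n χ_n)^(½+it)‖²` on it and `𝓔^χ_a(Σ c_n χ_n) − M^χ_a‖Σ c_n χ_n‖₂² < m`: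
NO non-trivial zero of `L(s, χ)` has its ordinate in `[l, r]`. -/
theorem im_not_mem_block_of_grh_of_twistedWindowForm_lt (hq : q ≠ 1) (hprim : χ.IsPrimitive)
    (hGRH : χ.RiemannHypothesis) (ha : 0 < a) (s : Finset ℤ) (c : ℤ → ℂ) {l r m : ℝ}
    (hm : ∀ t ∈ Icc l r, m ≤ ‖weilMellin (∑ n ∈ s, c n • chi a n) (1 / 2 + t * I)‖ ^ 2)
    (hlt : weilDirichletEnergyChar χ a (∑ n ∈ s, c n • chi a n) -
        weilMarkovConstantChar χ a * (∫ x : ℝ, ‖(∑ n ∈ s, c n • chi a n) x‖ ^ 2) < m)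
    {ρ : ℂ} (hρ : ρ ∈ charNontrivialZeros χ) :
    ρ.im ∉ Icc l r := by
  have hχ : χ ≠ 1 := by
    rintro rfl
    rw [DirichletCharacter.isPrimitive_def, DirichletCharacter.conductor_one] at hprim
    exact hq hprim.symm
  have hν := represents_charZeroHeightMeasure hq hprim hGRH a
  intro hmem
  have h1 := measureReal_block_lt_of_twistedWindowForm_lt hq χ ha hν s c one_pos hm (by rwa [one_mul])
  have hfin : charZeroHeightMeasure χ (Icc l r) ≠ ⊤ :=
    (measure_Icc_lt_top_of_integrable (integrable_inv_one_add_sq_of_represents χ ha hν) l r).ne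
  have hge' : (1 : ℝ) ≤ (charZeroHeightMeasure χ).real (Icc l r) := by
    rw [measureReal_def]
    have := ENNReal.toReal_mono hfin (one_le_charZeroHeightMeasure_block hχ hρ hmem)
    rwa [ENNReal.toReal_one] at this
  linarith

/-- **MULTIPLICITY / COUNT BOUND ON A BLOCK** (under `GRH(χ)`, `χ` primitive mod `q ≠ 1`): if `m ≤ ‖û‖²` on
`[l, r]`, `0 < k` and `𝓔^χ_a(u) − M^χ_a‖u‖₂² < k · m` (`u = Σ c_n χ_n`), then the zeros of `L(s, χ)` with ordinate in
`[l, r]`, counted with multiplicity, number `< k`: `ν_χ[l, r] < k`. -/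
theorem charZeroHeightMeasure_real_block_lt_of_grh (hq : q ≠ 1) (hprim : χ.IsPrimitive)
    (hGRH : χ.RiemannHypothesis) (ha : 0 < a) (s : Finset ℤ) (c : ℤ → ℂ) {l r m k : ℝ} (hk : 0 < k)
    (hm : ∀ t ∈ Icc l r, m ≤ ‖weilMellin (∑ n ∈ s, c n • chi a n) (1 / 2 + t * I)‖ ^ 2)
    (hlt : weilDirichletEnergyChar χ a (∑ n ∈ s, c n • chi a n) -
        weilMarkovConstantChar χ a * (∫ x : ℝ, ‖(∑ n ∈ s, c n • chi a n) x‖ ^ 2) < k * m) :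
    (charZeroHeightMeasure χ).real (Icc l r) < k :=
  measureReal_block_lt_of_twistedWindowForm_lt hq χ ha (represents_charZeroHeightMeasure hq hprim hGRH a)
    s c hk hm hlt

end GRH

end Summit.Ventures.WeilGRH

end
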